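import Mathlib.AlgebraicGeometry.AffineSpace
import Mathlib.RingTheory.MvPolynomial.Localization
import Literature.AlgebraicGeometry.Motives.RatFnSpec
import HarnessLib

/-!
# Affine charts of `𝔸ⁿ_X` and the polynomial rings over the local rings of `X`

For an integral scheme `X`, a finite type `n` and an affine open `U = Spec B ⊆ X`
(`B = Γ(X, U)`), the open subscheme `pr⁻¹(U) ⊆ 𝔸ⁿ_X` of relative affine `n`-space
`pr : 𝔸ⁿ_X → X` (Mathlib `𝔸(n; X)`, `AffineSpace`) is `Spec B[t]`, `t = (t_i)_{i ∈ n}`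
(Görtz–Wedhorn I, (1.19)/(3.12): `𝔸ⁿ_S = 𝔸ⁿ_ℤ ×_ℤ S`, and `𝔸ⁿ_{Spec B} = Spec B[t]`). This file
packages that chart in the form used by the divisor calculus of `Motives/CartierDivisor`:

* `AffineSpaceChart.chart U n : Spec B[t] → 𝔸ⁿ_X` — the open immersion
  `(SpecIso)⁻¹ ≫ 𝔸ⁿ(fromSpec)` (Mathlib `AffineSpace.SpecIso`, `AffineSpace.map`,
  `IsAffineOpen.fromSpec`), with `chart ≫ pr = Spec(C) ≫ fromSpec` (`chart_over`), covering
  `pr⁻¹(U)` (`exists_chart_eq`), and the criteria: `pr (chart 𝔓)` is the generic point of `X` iff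
  `𝔓 ∩ B = 0` (`over_chart_eq_genericPoint_iff`); a rational function `r` on `𝔸ⁿ_X` is a unit at
  `chart 𝔓` iff `chart^♯ r ∈ B[t]_𝔓^×` (`isUnitAt_chart_iff`); a section `b ∈ B` is a unit at
  `pr (chart 𝔓)` iff `C b ∉ 𝔓` (`isUnitAt_over_chart_iff`);
* `AffineSpaceChart.stalkPoly U n x = 𝒪_{X,x}[t]` for `x ∈ U` — a localisation of `B[t]`
  (Mathlib `MvPolynomial.isLocalization`), mapped into `K(Spec B[t])` (`stalkPolyAlgebra`, a
  fraction field of it), with: the prime `𝔔_𝔓 = 𝔓 𝒪_{X,x}[t]` of a point `chart 𝔓` over `x`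
  (`primeOver`; `isUnitAt_chart_iff_primeOver`: units at `chart 𝔓` = `𝒪_{X,x}[t]_{𝔔_𝔓}^×`), the
  point `pt 𝔮` of any prime `𝔮 ⊂ 𝒪_{X,x}[t]` (`isUnitAt_pt_iff`, `pt_specializes`,
  `over_pt_eq_genericPoint_iff`: `pt 𝔮` lies over the generic point of `X` iff
  `𝔮 ∩ 𝒪_{X,x} = 0`), the compatibility `𝒪_{X,x} → 𝒪_{X,x}[t] → K(Spec B[t])` =
  `𝒪_{X,x} → K(X) → K(𝔸ⁿ_X) → K(Spec B[t])` (`algebraMap_stalkPoly_C`), and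
  `C(𝔪_x) ⊆ 𝔔_𝔓` (`C_mem_primeOver_of_mem_maximalIdeal`);
* `AffineSpaceChart.isUnitAt_over_iff` — units ascend and descend along `pr : 𝔸ⁿ_X → X`.

This is the scheme-theoretic dictionary for the proof that Cartier divisors on `𝔸ⁿ_X`, `X`
locally factorial, are pulled back from `X` up to principal divisors
(`Motives/AffineSpaceDivisor`). Everything is proved; no named facts.

Mathlib searched (pin v4.32.0) and used: `AffineSpace.SpecIso(_inv_over)`, `AffineSpace.map(_over)`,
`AffineSpace.isPullback_map`, `IsPullback.isoPullback_inv_fst`,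
`Scheme.Pullback.exists_preimage_pullback`, `MorphismProperty.of_isPullback` (open immersions
are stable under base change), `IsAffineOpen.fromSpec_primeIdealOf`, `IsAffineOpen.range_fromSpec`,
`genericPoint_eq_of_isOpenImmersion`, `genericPoint_eq_bot_of_affine`,
`MvPolynomial.isLocalization`, `MvPolynomial.algebraMvPolynomial`, `IsLocalization.lift`,
`IsLocalization.isPrime_of_isPrime_disjoint`, `IsLocalization.comap_map_of_isPrime_disjoint`,
`IsLocalization.AtPrime.map_eq_maximalIdeal`, `IsLocalization.ringHom_ext`,
`IsFractionRing.isFractionRing_of_isDomain_of_isLocalization`; the tree's `Motives/RatFnSpec`,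
`Motives/RatFnAffine`, `RingTheory/UniqueFactorizationDomain/UnitsAtPrimes`.

## References

* U. Görtz, T. Wedhorn, *Algebraic Geometry I: Schemes*, 2nd ed., Springer Spektrum (2020),
  doi:10.1007/978-3-658-30733-2: (1.19) `𝔸ⁿ_R = Spec R[T₁, …, Tₙ]`, (4.11)/(4.13) fibre products
  and base change of `𝔸ⁿ`, (2.10.2) local rings of `Spec`. [GortzWedhorn2020]
-/

universe u

open CategoryTheory CategoryTheory.Limits AlgebraicGeometry TopologicalSpace Opposite
open Literature.RingTheory.UniqueFactorizationDomain
open Literature.AlgebraicGeometry.Motives.RatFn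

noncomputable section

namespace Literature.AlgebraicGeometry.Motives

namespace AffineSpaceChart

variable {X : Scheme.{u}} [IsIntegral X] (U : X.affineOpens) [Nonempty (U : X.Opens)]
  (n : Type u)

attribute [local instance] isDominant_fromSpec

/-! ### The chart `Spec B[t] → 𝔸ⁿ_X` over an affine open `U = Spec B` -/

/-- The polynomial ring `B[t]`, `B = Γ(X, U)`, `t = (t_i)_{i ∈ n}`, as a bundled ring. [folklore] -/
abbrev polyRing : CommRingCat.{u} := CommRingCat.of (MvPolynomial n Γ(X, U))

/-- `B[t]` is a domain. [folklore] -/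
instance isDomain_polyRing : IsDomain (polyRing U n) :=
  inferInstanceAs (IsDomain (MvPolynomial n Γ(X, U)))

/-- `B[t] → K(Spec B[t])` (Mathlib's instance, re-keyed for the reducible `polyRing`). [folklore] -/
instance algebra_polyRing_functionField :
    Algebra (polyRing U n) (Spec (polyRing U n)).functionField :=
  AlgebraicGeometry.instAlgebraCarrierFunctionFieldSpec (polyRing U n)

/-- `K(Spec B[t])` is the fraction field of `B[t]` (Mathlib's instance, re-keyed). [folklore] -/
instance isFractionRing_polyRing_functionField :
    IsFractionRing (polyRing U n) (Spec (polyRing U n)).functionField :=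
  AlgebraicGeometry.functionField_isFractionRing_of_affine (polyRing U n)

/-- **The chart `Spec B[t] → 𝔸ⁿ_X`** over the affine open `U = Spec B`: the composite of
Mathlib's `𝔸ⁿ_{Spec B} ≅ Spec B[t]` (inverted) with `𝔸ⁿ(fromSpec) : 𝔸ⁿ_{Spec B} → 𝔸ⁿ_X`
(Görtz–Wedhorn I, (1.19) and (4.11)). [cite: GortzWedhorn2020, (1.19) and (4.11)] -/
def chart : Spec (polyRing U n) ⟶ 𝔸(n; X) :=
  (AffineSpace.SpecIso n Γ(X, U)).inv ≫ AffineSpace.map n U.2.fromSpec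

/-- The chart is an open immersion (a base change of the open immersion `fromSpec`). [folklore] -/
instance isOpenImmersion_chart : IsOpenImmersion (chart U n) := by
  have : IsOpenImmersion (AffineSpace.map n U.2.fromSpec) :=
    MorphismProperty.of_isPullback (AffineSpace.isPullback_map U.2.fromSpec).flip inferInstance
  unfold chart; infer_instance

/-- The chart is dominant. [folklore] -/
instance isDominant_chart : IsDominant (chart U n) :=
  ⟨(chart U n).isOpenEmbedding.isOpen_range.dense ⟨_, Set.mem_range_self (genericPoint _)⟩⟩

omit [IsIntegral X] [Nonempty (U : X.Opens)] in
/-- **`chart ≫ pr = Spec(C) ≫ fromSpec`**: the chart lies over the chart of `U`, through the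
structure map `Spec B[t] → Spec B`. [folklore] -/
@[reassoc]
theorem chart_over : chart U n ≫ (𝔸(n; X) ↘ X) =
    Spec.map (CommRingCat.ofHom MvPolynomial.C) ≫ U.2.fromSpec := by
  simp [chart, AffineSpace.map_over]

omit [IsIntegral X] [Nonempty (U : X.Opens)] in
/-- `pr (chart 𝔓) = fromSpec (𝔓 ∩ B)` on points. [folklore] -/
theorem over_chart_apply (𝔓 : PrimeSpectrum (polyRing U n)) :
    (𝔸(n; X) ↘ X) (chart U n 𝔓) =
      U.2.fromSpec ⟨𝔓.asIdeal.comap (MvPolynomial.C : Γ(X, U) →+* MvPolynomial n Γ(X, U)),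
        inferInstance⟩ := by
  rw [← Scheme.Hom.comp_apply, chart_over, Scheme.Hom.comp_apply]
  rfl

omit [IsIntegral X] [Nonempty (U : X.Opens)] in
/-- **The chart covers `pr⁻¹(U)`**: every point of `𝔸ⁿ_X` over `U` is in the image of the chart
(points of the fibre product `𝔸ⁿ_X ×_X Spec B = 𝔸ⁿ_{Spec B}`, Mathlib
`Scheme.Pullback.exists_preimage_pullback` with `AffineSpace.isPullback_map`). [folklore] -/
theorem exists_chart_eq (z : 𝔸(n; X)) (hz : (𝔸(n; X) ↘ X) z ∈ (U : X.Opens)) :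
    ∃ 𝔓 : PrimeSpectrum (polyRing U n), chart U n 𝔓 = z := by
  obtain ⟨w, hw⟩ : ∃ w : Spec Γ(X, U), U.2.fromSpec w = (𝔸(n; X) ↘ X) z :=
    ⟨_, U.2.fromSpec_primeIdealOf ⟨_, hz⟩⟩
  obtain ⟨t, ht1, -⟩ := Scheme.Pullback.exists_preimage_pullback (f := (𝔸(n; X) ↘ X))
    (g := U.2.fromSpec) z w hw.symm
  let H := AffineSpace.isPullback_map (n := n) U.2.fromSpec
  refine ⟨(AffineSpace.SpecIso n Γ(X, U)).hom (H.isoPullback.inv t), ?_⟩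
  change ((AffineSpace.SpecIso n Γ(X, U)).hom ≫ (AffineSpace.SpecIso n Γ(X, U)).inv ≫
    AffineSpace.map n U.2.fromSpec) (H.isoPullback.inv t) = z
  rw [Iso.hom_inv_id_assoc]
  change (H.isoPullback.inv ≫ AffineSpace.map n U.2.fromSpec) t = z
  rw [IsPullback.isoPullback_inv_fst]
  exact ht1

/-- **`pr (chart 𝔓)` is the generic point of `X` iff `𝔓 ∩ B = 0`** (`fromSpec` is injective and
maps the generic point `(0)` of `Spec B` to that of `X`). [folklore] -/
theorem over_chart_eq_genericPoint_iff (𝔓 : PrimeSpectrum (polyRing U n)) :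
    (𝔸(n; X) ↘ X) (chart U n 𝔓) = genericPoint X ↔
      𝔓.asIdeal.comap (MvPolynomial.C : Γ(X, U) →+* MvPolynomial n Γ(X, U)) = ⊥ := by
  rw [over_chart_apply, ← genericPoint_eq_of_isOpenImmersion U.2.fromSpec,
    (U.2.fromSpec.isOpenEmbedding.injective).eq_iff, genericPoint_eq_bot_of_affine]
  constructor
  · intro h; exact congrArg PrimeSpectrum.asIdeal h
  · intro h; exact PrimeSpectrum.ext h

omit [IsIntegral X] [Nonempty (U : X.Opens)] in
/-- Inclusion of primes gives specialisation of the corresponding points of `𝔸ⁿ_X`. [folklore] -/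
theorem chart_specializes {𝔓 𝔓' : PrimeSpectrum (polyRing U n)} (h : 𝔓.asIdeal ≤ 𝔓'.asIdeal) :
    chart U n 𝔓 ⤳ chart U n 𝔓' :=
  (specializes_Spec_of_le (polyRing U n) h).map (chart U n).continuous

/-! ### Rational functions through the chart -/

/-- `Spec(C) : Spec B[t] → Spec B` is dominant (`C` is injective). [folklore] -/
instance isDominant_SpecMap_C :
    IsDominant (Spec.map (CommRingCat.ofHom (MvPolynomial.C : Γ(X, U) →+* MvPolynomial n Γ(X, U)))) :=
  isDominant_SpecMap_of_injective _ (MvPolynomial.C_injective n Γ(X, U))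

/-- **`chart^♯ ∘ pr^♯` on sections of `U`**: the rational function of `b ∈ B = Γ(X, U)`, pulled
back to `𝔸ⁿ_X` and then to `Spec B[t]`, is `C b ∈ K(Spec B[t])` (`chart ≫ pr = Spec(C) ≫ fromSpec`,
`functionFieldMap_fromSpec`, `functionFieldMap_SpecMap`). [folklore] -/
theorem functionFieldMap_chart_over (b : Γ(X, U)) :
    functionFieldMap (chart U n)
        (functionFieldMap (𝔸(n; X) ↘ X) (algebraMap Γ(X, U) X.functionField b)) =
      algebraMap (polyRing U n) (Spec (polyRing U n)).functionField (MvPolynomial.C b) := by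
  rw [← RingHom.comp_apply, ← functionFieldMap_comp,
    functionFieldMap_congr (chart_over U n), functionFieldMap_comp, RingHom.comp_apply,
    functionFieldMap_fromSpec, functionFieldMap_SpecMap]
  rfl

/-- **Units at a point of the chart**: a rational function `r` on `𝔸ⁿ_X` is a unit at
`chart 𝔓` iff `chart^♯ r ∈ B[t]_𝔓^×` (flat transfer along the open immersion, then
`𝒪_{Spec B[t], 𝔓} = B[t]_𝔓`). [cite: GortzWedhorn2020, (2.10.2)] -/
theorem isUnitAt_chart_iff (𝔓 : PrimeSpectrum (polyRing U n)) (r : (𝔸(n; X)).functionField) :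
    IsUnitAt (chart U n 𝔓) r ↔
      functionFieldMap (chart U n) r ∈ unitsAt (Spec (polyRing U n)).functionField 𝔓.asIdeal := by
  rw [← isUnitAt_Spec_iff_mem_unitsAt]
  exact isUnitAt_iff_of_flat (chart U n) 𝔓 r

/-- `Spec(C) : Spec B[t] → Spec B` is flat (`B[t]` is a free `B`-module). [folklore] -/
instance flat_SpecMap_C :
    Flat (Spec.map (CommRingCat.ofHom (MvPolynomial.C : Γ(X, U) →+* MvPolynomial n Γ(X, U)))) := by
  rw [HasRingHomProperty.Spec_iff (P := @Flat)]
  change (MvPolynomial.C : Γ(X, U) →+* MvPolynomial n Γ(X, U)).Flat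
  -- `C` is the structure map of the free algebra `B[t]`
  have : (MvPolynomial.C : Γ(X, U) →+* MvPolynomial n Γ(X, U)) =
      algebraMap Γ(X, U) (MvPolynomial n Γ(X, U)) := rfl
  rw [this, RingHom.flat_algebraMap_iff]
  infer_instance

/-- **Units at `pr (chart 𝔓)` versus units at `chart 𝔓`**: a rational function `h` on `X` is a
unit at `pr (chart 𝔓)` iff `chart^♯ (pr^♯ h) ∈ B[t]_𝔓^×` (flat transfer along
`Spec(C) ≫ fromSpec = chart ≫ pr`). [folklore] -/
theorem isUnitAt_over_chart_iff_mem (𝔓 : PrimeSpectrum (polyRing U n)) (h : X.functionField) :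
    IsUnitAt ((𝔸(n; X) ↘ X) (chart U n 𝔓)) h ↔
      functionFieldMap (chart U n) (functionFieldMap (𝔸(n; X) ↘ X) h) ∈
        unitsAt (Spec (polyRing U n)).functionField 𝔓.asIdeal := by
  have e : (𝔸(n; X) ↘ X) (chart U n 𝔓) =
      (Spec.map (CommRingCat.ofHom MvPolynomial.C) ≫ U.2.fromSpec) 𝔓 := by
    rw [← Scheme.Hom.comp_apply, chart_over]
  rw [e, isUnitAt_iff_of_flat (Spec.map (CommRingCat.ofHom MvPolynomial.C) ≫ U.2.fromSpec) 𝔓 h,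
    isUnitAt_Spec_iff_mem_unitsAt, ← functionFieldMap_congr (chart_over U n),
    functionFieldMap_comp, RingHom.comp_apply]

/-- **A section `b ∈ B` is a unit at `pr (chart 𝔓)` iff `C b ∉ 𝔓`.** [folklore] -/
theorem isUnitAt_over_chart_iff (𝔓 : PrimeSpectrum (polyRing U n)) (b : Γ(X, U)) :
    IsUnitAt ((𝔸(n; X) ↘ X) (chart U n 𝔓)) (algebraMap Γ(X, U) X.functionField b) ↔
      MvPolynomial.C b ∉ 𝔓.asIdeal := by
  rw [isUnitAt_over_chart_iff_mem, functionFieldMap_chart_over,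
    algebraMap_mem_unitsAt_iff (IsFractionRing.injective (polyRing U n) _)]

/-! ### The polynomial ring over a local ring of `X` -/

section StalkPoly

attribute [local instance] MvPolynomial.algebraMvPolynomial

variable (x : (U : X.Opens))

/-- **`𝒪_{X,x}[t]`**, the polynomial ring over the local ring at `x ∈ U` — a `B[t]`-algebra
through `B → 𝒪_{X,x}` on coefficients (Mathlib `MvPolynomial.algebraMvPolynomial`). [folklore] -/
abbrev stalkPoly : Type u := MvPolynomial n (X.presheaf.stalk (x : X))

/-- `𝒪_{X,x}[t]` is the localisation of `B[t]` at (the image of) `B ∖ 𝔭_x`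
(Mathlib `MvPolynomial.isLocalization` with `𝒪_{X,x} = B_{𝔭_x}`). [folklore] -/
instance isLocalization_stalkPoly :
    IsLocalization ((U.2.primeIdealOf x).asIdeal.primeCompl.map
      (MvPolynomial.C : Γ(X, U) →+* MvPolynomial n Γ(X, U))) (stalkPoly U n x) := by
  haveI := U.2.isLocalization_stalk x
  exact MvPolynomial.isLocalization _ _

/-- The elements of `C(B ∖ 𝔭_x)` are nonzero in `K(Spec B[t])`, hence units. [folklore] -/
theorem isUnit_algebraMap_of_mem_map
    (y : (U.2.primeIdealOf x).asIdeal.primeCompl.map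
      (MvPolynomial.C : Γ(X, U) →+* MvPolynomial n Γ(X, U))) :
    IsUnit (algebraMap (polyRing U n) (Spec (polyRing U n)).functionField y) := by
  obtain ⟨y, b, hb, rfl⟩ := y
  refine (Ne.isUnit ?_)
  intro h0
  have hb0 : (b : Γ(X, U)) ≠ 0 := fun e => hb (e ▸ (U.2.primeIdealOf x).asIdeal.zero_mem)
  exact hb0 (MvPolynomial.C_injective n Γ(X, U)
    (((map_eq_zero_iff _ (IsFractionRing.injective (polyRing U n) _)).1 h0).trans
      (MvPolynomial.C_0).symm))

/-- **`𝒪_{X,x}[t] → K(Spec B[t])`**, the unique extension of `B[t] → K(Spec B[t])` to the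
localisation (Mathlib `IsLocalization.lift`), as an algebra structure. [folklore] -/
instance stalkPolyAlgebra : Algebra (stalkPoly U n x) (Spec (polyRing U n)).functionField :=
  (IsLocalization.lift (M := (U.2.primeIdealOf x).asIdeal.primeCompl.map
      (MvPolynomial.C : Γ(X, U) →+* MvPolynomial n Γ(X, U))) (S := stalkPoly U n x)
    (g := algebraMap (polyRing U n) (Spec (polyRing U n)).functionField)
    (isUnit_algebraMap_of_mem_map U n x)).toAlgebra


/-- `B[t] → 𝒪_{X,x}[t] → K(Spec B[t])` is `B[t] → K(Spec B[t])`. [folklore] -/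
instance isScalarTower_stalkPoly :
    IsScalarTower (polyRing U n) (stalkPoly U n x) (Spec (polyRing U n)).functionField :=
  IsScalarTower.of_algebraMap_eq fun p => by
    change _ = IsLocalization.lift (isUnit_algebraMap_of_mem_map U n x)
      (algebraMap (polyRing U n) (stalkPoly U n x) p)
    rw [IsLocalization.lift_eq]

/-- `K(Spec B[t])` is a fraction field of `𝒪_{X,x}[t]`. [folklore] -/
instance isFractionRing_stalkPoly :
    IsFractionRing (stalkPoly U n x) (Spec (polyRing U n)).functionField :=
  IsFractionRing.isFractionRing_of_isDomain_of_isLocalization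
    ((U.2.primeIdealOf x).asIdeal.primeCompl.map
      (MvPolynomial.C : Γ(X, U) →+* MvPolynomial n Γ(X, U))) _ _

/-- `𝒪_{X,x}[t] → K(Spec B[t])` is injective. [folklore] -/
theorem algebraMap_stalkPoly_injective :
    Function.Injective (algebraMap (stalkPoly U n x) (Spec (polyRing U n)).functionField) :=
  IsFractionRing.injective _ _

omit [IsIntegral X] [Nonempty (U : X.Opens)] in
/-- On coefficients the algebra map `B[t] → 𝒪_{X,x}[t]` is `B → 𝒪_{X,x}`:
`(C b) ↦ C (b|_x)`. [folklore] -/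
theorem algebraMap_polyRing_stalkPoly_C (b : Γ(X, U)) :
    algebraMap (polyRing U n) (stalkPoly U n x) (MvPolynomial.C b) =
      MvPolynomial.C (algebraMap Γ(X, U) (X.presheaf.stalk (x : X)) b) := by
  change MvPolynomial.map (algebraMap Γ(X, U) (X.presheaf.stalk (x : X))) (MvPolynomial.C b) = _
  rw [MvPolynomial.map_C]

/-- **Compatibility of the two routes `𝒪_{X,x} → K(Spec B[t])`**: through `𝒪_{X,x}[t]` and its
algebra map, or through `K(X) →pr^♯ K(𝔸ⁿ_X) →chart^♯ K(Spec B[t])`. Both are ring maps out of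
the localisation `𝒪_{X,x} = B_{𝔭_x}` agreeing on `B` (`functionFieldMap_chart_over`).
[folklore] -/
theorem algebraMap_stalkPoly_C (t : X.presheaf.stalk (x : X)) :
    algebraMap (stalkPoly U n x) (Spec (polyRing U n)).functionField (MvPolynomial.C t) =
      functionFieldMap (chart U n) (functionFieldMap (𝔸(n; X) ↘ X) (toFunctionField (x : X) t)) := by
  haveI := U.2.isLocalization_stalk x
  let f₁ : X.presheaf.stalk (x : X) →+* (Spec (polyRing U n)).functionField :=
    (algebraMap (stalkPoly U n x) (Spec (polyRing U n)).functionField).comp MvPolynomial.C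
  let f₂ : X.presheaf.stalk (x : X) →+* (Spec (polyRing U n)).functionField :=
    ((functionFieldMap (chart U n)).comp (functionFieldMap (𝔸(n; X) ↘ X))).comp
      (toFunctionField (x : X))
  suffices h : f₁ = f₂ from RingHom.congr_fun h t
  refine IsLocalization.ringHom_ext (U.2.primeIdealOf x).asIdeal.primeCompl ?_
  ext b
  simp only [f₁, f₂, RingHom.comp_apply]
  rw [toFunctionField_algebraMap_stalk, functionFieldMap_chart_over,
    ← algebraMap_polyRing_stalkPoly_C, ← IsScalarTower.algebraMap_apply]

/-! ### Points of the chart over `x` and their primes in `𝒪_{X,x}[t]` -/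

variable {x}

/-- For a point `chart 𝔓` lying over `x`, the prime `𝔓 ⊂ B[t]` misses `C(B ∖ 𝔭_x)`. [folklore] -/
theorem disjoint_of_over_eq {𝔓 : PrimeSpectrum (polyRing U n)}
    (h𝔓 : (𝔸(n; X) ↘ X) (chart U n 𝔓) = x) :
    Disjoint (((U.2.primeIdealOf x).asIdeal.primeCompl.map
      (MvPolynomial.C : Γ(X, U) →+* MvPolynomial n Γ(X, U)) : Submonoid (MvPolynomial n Γ(X, U))) : Set _)
      (𝔓.asIdeal : Set (MvPolynomial n Γ(X, U))) := by
  rw [Set.disjoint_left]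
  rintro _ ⟨b, hb, rfl⟩ hb𝔓
  have h1 : IsUnitAt ((𝔸(n; X) ↘ X) (chart U n 𝔓)) (algebraMap Γ(X, U) X.functionField b) := by
    rw [h𝔓]; exact (isUnitAt_algebraMap_iff U.2 x b).2 hb
  exact (isUnitAt_over_chart_iff U n 𝔓 b).1 h1 hb𝔓

/-- **The prime `𝔔_𝔓 = 𝔓 𝒪_{X,x}[t]`** of `𝒪_{X,x}[t]` attached to a point `chart 𝔓` over `x`.
[folklore] -/
def primeOver (𝔓 : PrimeSpectrum (polyRing U n)) : Ideal (stalkPoly U n x) :=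
  𝔓.asIdeal.map (algebraMap (polyRing U n) (stalkPoly U n x))

/-- `𝔔_𝔓` is prime (for `chart 𝔓` over `x`). [folklore] -/
theorem isPrime_primeOver {𝔓 : PrimeSpectrum (polyRing U n)}
    (h𝔓 : (𝔸(n; X) ↘ X) (chart U n 𝔓) = x) : (primeOver U n (x := x) 𝔓).IsPrime :=
  IsLocalization.isPrime_of_isPrime_disjoint _ (stalkPoly U n x) 𝔓.asIdeal 𝔓.2
    (disjoint_of_over_eq U n h𝔓)

/-- `𝔔_𝔓 ∩ B[t] = 𝔓`. [folklore] -/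
theorem comap_primeOver {𝔓 : PrimeSpectrum (polyRing U n)}
    (h𝔓 : (𝔸(n; X) ↘ X) (chart U n 𝔓) = x) :
    (primeOver U n (x := x) 𝔓).comap (algebraMap (polyRing U n) (stalkPoly U n x)) = 𝔓.asIdeal :=
  IsLocalization.under_map_of_isPrime_disjoint _ (stalkPoly U n x) 𝔓.2
    (disjoint_of_over_eq U n h𝔓)

/-- **Units at a point over `x`, read in `𝒪_{X,x}[t]`**: `r` is a unit at `chart 𝔓` iff
`chart^♯ r ∈ 𝒪_{X,x}[t]_{𝔔_𝔓}^×` (`B[t]_𝔓 = 𝒪_{X,x}[t]_{𝔔_𝔓}`, `unitsAt_comap_eq`).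
[cite: GortzWedhorn2020, (2.10.2)] -/
theorem isUnitAt_chart_iff_primeOver {𝔓 : PrimeSpectrum (polyRing U n)}
    (h𝔓 : (𝔸(n; X) ↘ X) (chart U n 𝔓) = x) (r : (𝔸(n; X)).functionField) :
    haveI := isPrime_primeOver U n h𝔓
    IsUnitAt (chart U n 𝔓) r ↔ functionFieldMap (chart U n) r ∈
      unitsAt (Spec (polyRing U n)).functionField (primeOver U n (x := x) 𝔓) := by
  haveI := isPrime_primeOver U n h𝔓
  rw [isUnitAt_chart_iff, ← unitsAt_comap_eq (L := (Spec (polyRing U n)).functionField)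
    ((U.2.primeIdealOf x).asIdeal.primeCompl.map
      (MvPolynomial.C : Γ(X, U) →+* MvPolynomial n Γ(X, U))) (primeOver U n (x := x) 𝔓)]
  simp only [comap_primeOver U n h𝔓]

/-- **`C(𝔪_x) ⊆ 𝔔_𝔓`** for a point `chart 𝔓` over `x`: a coefficient in the maximal ideal of
`𝒪_{X,x}` is not a unit at `x`, so its constant polynomial lies in the prime of every point over
`x` (`𝔪_x = 𝔭_x 𝒪_{X,x}`, Mathlib `IsLocalization.AtPrime.map_eq_maximalIdeal`). [folklore] -/
theorem C_mem_primeOver_of_mem_maximalIdeal {𝔓 : PrimeSpectrum (polyRing U n)}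
    (h𝔓 : (𝔸(n; X) ↘ X) (chart U n 𝔓) = x) {t : X.presheaf.stalk (x : X)}
    (ht : t ∈ IsLocalRing.maximalIdeal (X.presheaf.stalk (x : X))) :
    MvPolynomial.C t ∈ primeOver U n (x := x) 𝔓 := by
  haveI := U.2.isLocalization_stalk x
  rw [← IsLocalization.AtPrime.map_eq_maximalIdeal (U.2.primeIdealOf x).asIdeal
    (X.presheaf.stalk (x : X))] at ht
  -- `C (𝔭_x 𝒪_{X,x}) ⊆ 𝔔_𝔓`
  have key : ((U.2.primeIdealOf x).asIdeal.map (algebraMap Γ(X, U) (X.presheaf.stalk (x : X)))).map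
      (MvPolynomial.C : X.presheaf.stalk (x : X) →+* stalkPoly U n x) ≤ primeOver U n (x := x) 𝔓 := by
    rw [Ideal.map_map, Ideal.map_le_iff_le_comap]
    intro b hb
    rw [Ideal.mem_comap, RingHom.comp_apply, ← algebraMap_polyRing_stalkPoly_C]
    refine Ideal.mem_map_of_mem _ ?_
    by_contra hb𝔓
    have h1 := (isUnitAt_over_chart_iff U n 𝔓 b).2 hb𝔓
    rw [h𝔓, isUnitAt_algebraMap_iff U.2 x b] at h1
    exact h1 hb
  exact key (Ideal.mem_map_of_mem _ ht)

/-! ### The point of a prime of `𝒪_{X,x}[t]` -/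

/-- **The point `pt 𝔮 ∈ 𝔸ⁿ_X` of a prime `𝔮 ⊂ 𝒪_{X,x}[t]`**: the image under the chart of
`𝔮 ∩ B[t]`. [folklore] -/
def pt (𝔮 : Ideal (stalkPoly U n x)) [𝔮.IsPrime] : 𝔸(n; X) :=
  chart U n ⟨𝔮.comap (algebraMap (polyRing U n) (stalkPoly U n x)), Ideal.IsPrime.comap _⟩

/-- **Units at `pt 𝔮`** are the elements of `𝒪_{X,x}[t]_𝔮^×`. [cite: GortzWedhorn2020, (2.10.2)] -/
theorem isUnitAt_pt_iff (𝔮 : Ideal (stalkPoly U n x)) [𝔮.IsPrime] (r : (𝔸(n; X)).functionField) :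
    IsUnitAt (pt U n 𝔮) r ↔
      functionFieldMap (chart U n) r ∈ unitsAt (Spec (polyRing U n)).functionField 𝔮 := by
  rw [pt, isUnitAt_chart_iff, ← unitsAt_comap_eq (L := (Spec (polyRing U n)).functionField)
    ((U.2.primeIdealOf x).asIdeal.primeCompl.map
      (MvPolynomial.C : Γ(X, U) →+* MvPolynomial n Γ(X, U))) 𝔮]

/-- `pt 𝔮` generises `chart 𝔓` when `𝔮 ⊆ 𝔔_𝔓` (for `chart 𝔓` over `x`). [folklore] -/
theorem pt_specializes {𝔓 : PrimeSpectrum (polyRing U n)}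
    (h𝔓 : (𝔸(n; X) ↘ X) (chart U n 𝔓) = x) (𝔮 : Ideal (stalkPoly U n x)) [𝔮.IsPrime]
    (h : 𝔮 ≤ primeOver U n (x := x) 𝔓) : pt U n 𝔮 ⤳ chart U n 𝔓 := by
  refine chart_specializes U n ?_
  change 𝔮.comap _ ≤ 𝔓.asIdeal
  rw [← comap_primeOver U n h𝔓]
  exact Ideal.comap_mono h

omit [IsIntegral X] [Nonempty (U : X.Opens)] in
/-- `pt 𝔮` generises `pt 𝔮'` when `𝔮 ⊆ 𝔮'`. [folklore] -/
theorem pt_specializes_pt (𝔮 𝔮' : Ideal (stalkPoly U n x)) [𝔮.IsPrime] [𝔮'.IsPrime] (h : 𝔮 ≤ 𝔮') :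
    pt U n 𝔮 ⤳ pt U n 𝔮' :=
  chart_specializes U n (Ideal.comap_mono h)

/-- An ideal of the localisation `𝒪_{X,x}` of the domain `B` meets `B` non-trivially unless it is
zero. [folklore] -/
theorem comap_stalk_eq_bot_iff (J : Ideal (X.presheaf.stalk (x : X))) :
    J.comap (algebraMap Γ(X, U) (X.presheaf.stalk (x : X))) = ⊥ ↔ J = ⊥ := by
  haveI := U.2.isLocalization_stalk x
  constructor
  · intro h
    rw [eq_bot_iff]
    intro j hj
    obtain ⟨⟨b, s⟩, e⟩ := IsLocalization.surj (U.2.primeIdealOf x).asIdeal.primeCompl j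
    simp only at e
    have hb : b ∈ J.comap (algebraMap Γ(X, U) (X.presheaf.stalk (x : X))) := by
      rw [Ideal.mem_comap, ← e]; exact J.mul_mem_right _ hj
    rw [h, Ideal.mem_bot] at hb
    rw [hb, map_zero, mul_eq_zero] at e
    rcases e with e | e
    · exact e
    · exact absurd e (IsLocalization.map_units (X.presheaf.stalk (x : X)) s).ne_zero
  · rintro rfl
    rw [Ideal.comap_bot_of_injective _ (algebraMap_stalk_injective x)]

/-- **`pt 𝔮` lies over the generic point of `X` iff `𝔮 ∩ 𝒪_{X,x} = 0`** ("horizontal"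
primes). [folklore] -/
theorem over_pt_eq_genericPoint_iff (𝔮 : Ideal (stalkPoly U n x)) [𝔮.IsPrime] :
    (𝔸(n; X) ↘ X) (pt U n 𝔮) = genericPoint X ↔
      𝔮.comap (MvPolynomial.C : X.presheaf.stalk (x : X) →+* stalkPoly U n x) = ⊥ := by
  rw [pt, over_chart_eq_genericPoint_iff,
    ← comap_stalk_eq_bot_iff U (x := x) (𝔮.comap MvPolynomial.C)]
  change Ideal.comap MvPolynomial.C
    (Ideal.comap (algebraMap (polyRing U n) (stalkPoly U n x)) 𝔮) = ⊥ ↔ _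
  rw [Ideal.comap_comap, Ideal.comap_comap]
  have e : (algebraMap (polyRing U n) (stalkPoly U n x)).comp
      (MvPolynomial.C : Γ(X, U) →+* MvPolynomial n Γ(X, U)) =
      (MvPolynomial.C : X.presheaf.stalk (x : X) →+* stalkPoly U n x).comp
        (algebraMap Γ(X, U) (X.presheaf.stalk (x : X))) := by
    refine RingHom.ext fun b => ?_
    simp only [RingHom.comp_apply]
    exact algebraMap_polyRing_stalkPoly_C U n x b
  rw [e]

end StalkPoly

/-! ### Units along `pr : 𝔸ⁿ_X → X` -/

section Over

variable {X : Scheme.{u}} [IsIntegral X] (n : Type u)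

/-- **Units ascend and descend along `pr : 𝔸ⁿ_X → X`**: a rational function `h` on `X` is a unit
at `pr z` iff `pr^♯ h` is a unit at `z` (read in a chart `Spec B[t]` around `z`:
`isUnitAt_over_chart_iff_mem` and `isUnitAt_chart_iff`). [folklore] -/
theorem isUnitAt_over_iff (z : 𝔸(n; X)) (h : X.functionField) :
    IsUnitAt ((𝔸(n; X) ↘ X) z) h ↔ IsUnitAt z (functionFieldMap (𝔸(n; X) ↘ X) h) := by
  obtain ⟨U', hU', hzU', -⟩ := exists_isAffineOpen_mem_and_subset
    (show (𝔸(n; X) ↘ X) z ∈ (⊤ : X.Opens) from trivial)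
  obtain ⟨U, hzU⟩ : ∃ U : X.affineOpens, (𝔸(n; X) ↘ X) z ∈ (U : X.Opens) := ⟨⟨U', hU'⟩, hzU'⟩
  haveI : Nonempty (U : X.Opens) := ⟨⟨_, hzU⟩⟩
  obtain ⟨𝔓, rfl⟩ := exists_chart_eq U n z hzU
  rw [isUnitAt_over_chart_iff_mem, isUnitAt_chart_iff]

end Over

end AffineSpaceChart

end Literature.AlgebraicGeometry.Motives

end
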